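import Summits.CriticalPhenomena.PercolationContinuityZ3.Theorems.Transplant.SkelNegBChoiceAllT
import Summits.CriticalPhenomena.PercolationContinuityZ3.Theorems.Transplant.SkelNeg1ChoiceO
import HarnessLib

/-!
# N1 (the `{±1}` node), (F) column (glue): **`FaceHoldsRNOFn` OF THE CHOICE FUNCTION OF RECORD `negChoiceAllOT` FROM THE PER-POINT FACE
# RESIDUE** — `PlanarSkeletonNeg.faceHoldsRNOFn_negChoiceAllOT_of`: if at every `(κ, G, Φ, t, p, hC, O, q)` with `(NegB.choiceAtOT …).AtQO O q`
# (one vertex type, `0 < p < 1`) the residue `Skelφ.FaceOblRM G ((choiceAtOT …).scheme O q) ((choiceAtOT …).FD O q) Φ.Δ κ.δ₂` holds, then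
# `FaceHoldsRNOFn (negChoiceAllOT gv fv Pv Sv)` — the (F) hypothesis `hF` of `samePDropOfSkeletonNeg₁_of_choiceFnNO(W)`. Pure glue
# (`negChoiceAllOT_eq`), plus **`NegB.choiceAtOT_face_iff`**: the scheme and face data of record BY NAME (`⟨cellGeomSG₂b G F P t (concRadii2N …) b₀, q, κ.δ⟩`,
# `faceDataSG …`) — the shape `Skelφ.faceOblRM_fineNb2` (p301391) with `hkits := Skelφ.hkits_faceSteps_of_nums5` (p308065) concludes.
# (The (F) twin of p5-g9's `SkelPhiNegReachGlue`.)
builds on p205010 (kernel theorem, internal audit signed; external expert review pending) — nothing in this file uses p205010; NOTHING is claimed about the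
open node `SamePDropOfSkeletonNeg`.
Lane `prim-bschramm`, seat `prim-hp-8` (gen 33; (F) column); helper file (`--supports stmt-CriticalPhenomena-4575 --as helper`).
[cite: KozmaNitzan2024, §4 Theorem 6 (pp. 25–31), Lemma 12 (pp. 23–25)] [folklore]
-/

noncomputable section

open scoped Classical

namespace Summit.CriticalPhenomena.PercolationContinuityZ3.Theorems.Transplant

namespace PlanarSkeletonNeg

open SkelConc (Consts)
open Skelφ.StepI (OutO)
open Literature.Probability.Percolation

/-- **`FaceHoldsRNOFn (negChoiceAllOT …)` from the per-point face residue at `AtQO`.** [folklore] -/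
theorem faceHoldsRNOFn_negChoiceAllOT_of (gv fv : Neg.FSlot) (Pv : NegB.PSlot) (Sv : NegB.SSlot)
    (h : ∀ (κ : Consts) {V : Type} [DecidableEq V] [Countable V] (G : SimpleGraph V) [G.LocallyFinite] (Φ : PlanarSkeletonNeg G) (t : V) (p : unitInterval)
      (hC : Φ.CylSubcritical p) (O : OutO V) (q : unitInterval), (NegB.choiceAtOT κ Φ t p gv fv Sv hC Pv).AtQO O q → Φ.types = {t} → 0 < (p : ℝ) → (p : ℝ) < 1 →
      Skelφ.FaceOblRM G ((NegB.choiceAtOT κ Φ t p gv fv Sv hC Pv).scheme O q) ((NegB.choiceAtOT κ Φ t p gv fv Sv hC Pv).FD O q) Φ.Δ κ.δ₂) :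
    FaceHoldsRNOFn (negChoiceAllOT gv fv Pv Sv) := by
  intro κ V _ _ G _ Φ hg t ht h1 p hp0 hp1 hC O q hAt
  rw [negChoiceAllOT_eq] at hAt ⊢
  exact h κ G Φ t p hC O q hAt h1 hp0 hp1

/-- **The scheme and face data of record, by name** (face residue): the shape `Skelφ.faceOblRM_fineNb2` concludes. [folklore] -/
theorem NegB.choiceAtOT_face_iff (κ : Consts) {V : Type} [DecidableEq V] [Countable V] {G : SimpleGraph V} [G.LocallyFinite] (Φ : PlanarSkeletonNeg G) (t : V)
    (p : unitInterval) (gv fv : Neg.FSlot) (Sv : NegB.SSlot) (hC : Φ.CylSubcritical p) (Pv : NegB.PSlot) (O : OutO V) (q : unitInterval) {Δ : ℕ} {δ₂ : ℝ} :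
    Skelφ.FaceOblRM G ((NegB.choiceAtOT κ Φ t p gv fv Sv hC Pv).scheme O q) ((NegB.choiceAtOT κ Φ t p gv fv Sv hC Pv).FD O q) Δ δ₂ ↔
      Skelφ.FaceOblRM G
        (⟨Skelφ.cellGeomSG₂b G (NegB.fineO κ Φ t p O.D O.DT O.ori (NegB.gOf κ Φ t p O gv) (NegB.fOf κ Φ t p O fv))
            (NegB.fcells κ Φ t p O.merged (NegB.gOf κ Φ t p O gv) (NegB.fOf κ Φ t p O fv)) t
            (Skelφ.concRadii2N (NegB.fcells κ Φ t p O.merged (NegB.gOf κ Φ t p O gv) (NegB.fOf κ Φ t p O fv))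
              (Skelφ.Prm.gap (Sv κ Φ t p O.merged (NegB.gOf κ Φ t p O gv) (NegB.fOf κ Φ t p O fv) q)) (fun _ => 0)
              (Skelφ.Prm.E₀ (Sv κ Φ t p O.merged (NegB.gOf κ Φ t p O gv) (NegB.fOf κ Φ t p O fv) q))
              (Skelφ.Prm.Lp (Sv κ Φ t p O.merged (NegB.gOf κ Φ t p O gv) (NegB.fOf κ Φ t p O fv) q))
              (NegB.offN κ Φ t p O.merged (NegB.gOf κ Φ t p O gv) (NegB.fOf κ Φ t p O fv)))
            (NegB.b0T κ Φ t p O.merged (NegB.gOf κ Φ t p O gv) (NegB.fOf κ Φ t p O fv)), q, κ.δ⟩ : KNCells.KSchA V ℕ)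
        (Skelφ.faceDataSG G (NegB.fineO κ Φ t p O.D O.DT O.ori (NegB.gOf κ Φ t p O gv) (NegB.fOf κ Φ t p O fv))
          (NegB.fcells κ Φ t p O.merged (NegB.gOf κ Φ t p O gv) (NegB.fOf κ Φ t p O fv)) t
          (Skelφ.concRadii2N (NegB.fcells κ Φ t p O.merged (NegB.gOf κ Φ t p O gv) (NegB.fOf κ Φ t p O fv))
            (Skelφ.Prm.gap (Sv κ Φ t p O.merged (NegB.gOf κ Φ t p O gv) (NegB.fOf κ Φ t p O fv) q)) (fun _ => 0)
            (Skelφ.Prm.E₀ (Sv κ Φ t p O.merged (NegB.gOf κ Φ t p O gv) (NegB.fOf κ Φ t p O fv) q))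
            (Skelφ.Prm.Lp (Sv κ Φ t p O.merged (NegB.gOf κ Φ t p O gv) (NegB.fOf κ Φ t p O fv) q))
            (NegB.offN κ Φ t p O.merged (NegB.gOf κ Φ t p O gv) (NegB.fOf κ Φ t p O fv))))
        Δ δ₂ :=
  Iff.rfl

end PlanarSkeletonNeg

end Summit.CriticalPhenomena.PercolationContinuityZ3.Theorems.Transplant

end
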